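import Summits.AtomisticToContinuum.HydrodynamicLimit.Theses.LambertianContactSwap
import Summits.AtomisticToContinuum.HydrodynamicLimit.Theorems.JParityClosureParityInBandSmoothTest
import Summits.AtomisticToContinuum.HydrodynamicLimit.Theorems.JParityClosureParityInBandEnergyTight
import Summits.AtomisticToContinuum.HydrodynamicLimit.Theorems.OneFlightGossipEngineUniformLocalGibbsConcentrationFields
import Summits.AtomisticToContinuum.HydrodynamicLimit.Theorems.LambertianContactSwapSwapGapEntropyBudgetStatics
import Summits.AtomisticToContinuum.HydrodynamicLimit.Theorems.LambertianContactSwapSwapGapEntropyTransfer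
import Literature.MathematicalPhysics.KineticTheory.LambertianHardSphereFlow
import Literature.MathematicalPhysics.KineticTheory.HardSphereEulerProofs
import Literature.Analysis.FunctionSpaces.TorusFourierSynthesis
import HarnessLib

/-!
# `SwapGap` (stmt-AtomisticToContinuum-11850), line `Sketch`, stub T15 — tools

Helper file (`--supports stmt-AtomisticToContinuum-11850`) of line `Sketch` (card
`entropy-relative-to-lambertian-law`) for the crux
`Summit.AtomisticToContinuum.HydrodynamicLimit.Theses.LambertianContactSwap.SwapGap`: the tools of
the registered interface stub T15 `stub_linearConcentration_of_fourierModes` (Fourier modes suffice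
on the `Λ`-side), proved in the sequel file `…StubLinearConcentrationOfFourierModes`:
abstract bookkeeping (`expConc_finset_sum_smul`: union bound for finite linear combinations of
exponentially self-averaging statistics; `expConc_sub_integral_of_near_finset_sum`: concentration
about the mean passes from `∑_j a_j Y_j` to a statistic `G` with `‖G − ∑_j a_j Y_j‖ ≤ τ W`, `W` an
integrable weight bounded off an exponentially small event); Fourier (`exists_finset_uniform_tail`,
`hasSum_re_fourier_of_isSmooth`: a smooth real `χ` on `𝕋ᵈ` is `∑_k (Re ĉ_k Re e_k − Im ĉ_k Im e_k)`
with `∑_k ‖ĉ_k‖ < ∞`); the gas (linearity of the three tested empirical fields in the test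
function, their bounds by the kinetic energy per particle `e_1`, `e_1(Λ_t p) ≤ e_1(p.1)`, the
uniform first moment of `e_1` under the local Gibbs laws, integrability of the fields of `Λ_t`).

prover-line-stmt-AtomisticToContinuum-11850-c5-0 (wave 7 worker), cycle 6.
-/

noncomputable section

open MeasureTheory Filter Set Topology
open scoped ENNReal

namespace Summit.AtomisticToContinuum.HydrodynamicLimit.Theorems.LinearConcentrationOfFourierModes

open Literature.Analysis.FluidPDE Literature.MathematicalPhysics.KineticTheory
open Literature.Analysis.FunctionSpaces

/-! ### Abstract bookkeeping -/

/-- **Union bound for finite linear combinations.** If each `Y_j` (`j ∈ J`, `J` finite)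
concentrates exponentially at speed `N + 1` about constants `m_j`, at every level, then so does
`∑_{j∈J} a_j • (Y_j − m_j)` about `0`. [folklore] -/
theorem expConc_finset_sum_smul {Ω : ℕ → Type*} [∀ N, MeasurableSpace (Ω N)]
    {E : Type*} [NormedAddCommGroup E] [NormedSpace ℝ E]
    (μ : (N : ℕ) → Measure (Ω N)) {ι : Type*} (J : Finset ι) (a : ι → ℝ)
    (Y : ι → (N : ℕ) → Ω N → E) (m : ι → ℕ → E)
    (hY : ∀ j ∈ J, ∀ δ : ℝ, 0 < δ → ∃ C : ℝ, 0 < C ∧ ∀ N : ℕ,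
      μ N {x | δ < ‖Y j N x - m j N‖} ≤ ENNReal.ofReal (C * Real.exp (-(C⁻¹ * ((N : ℝ) + 1))))) :
    ∀ δ : ℝ, 0 < δ → ∃ C : ℝ, 0 < C ∧ ∀ N : ℕ,
      μ N {x | δ < ‖∑ j ∈ J, a j • (Y j N x - m j N)‖} ≤
        ENNReal.ofReal (C * Real.exp (-(C⁻¹ * ((N : ℝ) + 1)))) := by
  classical
  induction J using Finset.induction_on with
  | empty =>
    intro δ hδ
    refine ⟨1, one_pos, fun N => ?_⟩
    have h0 : {x : Ω N | δ < ‖∑ j ∈ (∅ : Finset ι), a j • (Y j N x - m j N)‖} = ∅ := by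
      ext x
      simp only [Finset.sum_empty, norm_zero, mem_setOf_eq, mem_empty_iff_false, iff_false, not_lt]
      exact hδ.le
    rw [h0, measure_empty]
    exact zero_le
  | insert i J hi ih =>
    intro δ hδ
    have hA : 0 < |a i| + 1 := by positivity
    obtain ⟨C₁, hC₁, h₁⟩ := hY i (Finset.mem_insert_self i J) (δ / (2 * (|a i| + 1))) (by positivity)
    obtain ⟨C₂, hC₂, h₂⟩ := ih (fun j hj => hY j (Finset.mem_insert_of_mem hj)) (δ / 2) (half_pos hδ)
    refine ⟨C₁ + C₂, add_pos hC₁ hC₂, fun N => ?_⟩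
    have hsub : {x | δ < ‖∑ j ∈ insert i J, a j • (Y j N x - m j N)‖} ⊆
        {x | δ / (2 * (|a i| + 1)) < ‖Y i N x - m i N‖} ∪
          {x | δ / 2 < ‖∑ j ∈ J, a j • (Y j N x - m j N)‖} := by
      intro x hx
      simp only [mem_setOf_eq, mem_union] at hx ⊢
      by_contra hcon
      rw [not_or, not_lt, not_lt] at hcon
      rw [Finset.sum_insert hi] at hx
      have h1 : ‖a i • (Y i N x - m i N)‖ ≤ δ / 2 := by
        rw [norm_smul, Real.norm_eq_abs]
        calc |a i| * ‖Y i N x - m i N‖ ≤ |a i| * (δ / (2 * (|a i| + 1))) :=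
              mul_le_mul_of_nonneg_left hcon.1 (abs_nonneg _)
          _ = (δ / 2) * (|a i| / (|a i| + 1)) := by field_simp
          _ ≤ (δ / 2) * 1 :=
              mul_le_mul_of_nonneg_left ((div_le_one hA).2 (by linarith)) (by positivity)
          _ = δ / 2 := mul_one _
      have := norm_add_le (a i • (Y i N x - m i N)) (∑ j ∈ J, a j • (Y j N x - m j N))
      linarith [hcon.2]
    calc μ N {x | δ < ‖∑ j ∈ insert i J, a j • (Y j N x - m j N)‖}
        ≤ μ N {x | δ / (2 * (|a i| + 1)) < ‖Y i N x - m i N‖} +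
            μ N {x | δ / 2 < ‖∑ j ∈ J, a j • (Y j N x - m j N)‖} :=
          (measure_mono hsub).trans (measure_union_le _ _)
      _ ≤ ENNReal.ofReal (C₁ * Real.exp (-(C₁⁻¹ * ((N : ℝ) + 1)))) +
            ENNReal.ofReal (C₂ * Real.exp (-(C₂⁻¹ * ((N : ℝ) + 1)))) := add_le_add (h₁ N) (h₂ N)
      _ ≤ ENNReal.ofReal ((C₁ + C₂) * Real.exp (-((C₁ + C₂)⁻¹ * ((N : ℝ) + 1)))) :=
          UniformLGC.ofReal_Kexp_add_le hC₁ hC₂ (by positivity)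

/-- **Exponential concentration about the mean for a statistic that is close to a finite linear
combination of self-averaging statistics.** On measure spaces `(Ω_N, μ_N)`: `Y_j`
(`j ∈ J` finite) integrable and exponentially concentrated about their means at every level;
`G_N` integrable with `‖G_N − ∑_j a_j • Y_j‖ ≤ τ W_N` for an integrable weight `W_N ≥ 0` with
`∫ W_N ≤ M`, and `W_N ≤ L` off events `B_N` of measure `≤ C₁ e^{-(N+1)/C₁}`; if
`τ L ≤ δ/8` and `τ M ≤ δ/4` then `μ_N{δ < ‖G_N − ∫ G_N‖} ≤ C e^{-(N+1)/C}`. Proof: the means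
satisfy `‖∫ G_N − ∑_j a_j • ∫ Y_j‖ ≤ τ ∫ W_N ≤ δ/4`, so the event lies in
`B_N ∪ {δ/2 < ‖∑_j a_j • (Y_j − ∫ Y_j)‖}` (union bound `expConc_finset_sum_smul`). [folklore] -/
theorem expConc_sub_integral_of_near_finset_sum {Ω : ℕ → Type*} [∀ N, MeasurableSpace (Ω N)]
    {E : Type*} [NormedAddCommGroup E] [NormedSpace ℝ E] [CompleteSpace E]
    (μ : (N : ℕ) → Measure (Ω N))
    {ι : Type*} (J : Finset ι) (a : ι → ℝ) (Y : ι → (N : ℕ) → Ω N → E)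
    (hYi : ∀ j ∈ J, ∀ N, Integrable (Y j N) (μ N))
    (hY : ∀ j ∈ J, ∀ δ : ℝ, 0 < δ → ∃ C : ℝ, 0 < C ∧ ∀ N : ℕ,
      μ N {x | δ < ‖Y j N x - ∫ y, Y j N y ∂μ N‖} ≤
        ENNReal.ofReal (C * Real.exp (-(C⁻¹ * ((N : ℝ) + 1)))))
    (G : (N : ℕ) → Ω N → E) (hGi : ∀ N, Integrable (G N) (μ N))
    (W : (N : ℕ) → Ω N → ℝ) (hWi : ∀ N, Integrable (W N) (μ N)) {M : ℝ}
    (hWM : ∀ N, ∫ x, W N x ∂μ N ≤ M)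
    (B : (N : ℕ) → Set (Ω N)) {L : ℝ} (hWL : ∀ N x, x ∉ B N → W N x ≤ L)
    {C₁ : ℝ} (hC₁ : 0 < C₁)
    (hBμ : ∀ N, μ N (B N) ≤ ENNReal.ofReal (C₁ * Real.exp (-(C₁⁻¹ * ((N : ℝ) + 1)))))
    {τ δ : ℝ} (hτ : 0 ≤ τ) (hδ : 0 < δ) (hτL : τ * L ≤ δ / 8) (hτM : τ * M ≤ δ / 4)
    (hGY : ∀ N x, ‖G N x - ∑ j ∈ J, a j • Y j N x‖ ≤ τ * W N x) :
    ∃ C : ℝ, 0 < C ∧ ∀ N : ℕ, μ N {x | δ < ‖G N x - ∫ y, G N y ∂μ N‖} ≤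
      ENNReal.ofReal (C * Real.exp (-(C⁻¹ * ((N : ℝ) + 1)))) := by
  obtain ⟨C₂, hC₂, h₂⟩ := expConc_finset_sum_smul μ J a Y (fun j N => ∫ y, Y j N y ∂μ N) hY
    (δ / 2) (half_pos hδ)
  -- the means are close
  have hmean : ∀ N, ‖(∫ y, G N y ∂μ N) - ∑ j ∈ J, a j • ∫ y, Y j N y ∂μ N‖ ≤ δ / 4 := by
    intro N
    have hSi : ∀ j ∈ J, Integrable (fun x => a j • Y j N x) (μ N) :=
      fun j hj => (hYi j hj N).smul (a j)
    have hint : (∫ y, G N y ∂μ N) - ∑ j ∈ J, a j • ∫ y, Y j N y ∂μ N =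
        ∫ y, (G N y - ∑ j ∈ J, a j • Y j N y) ∂μ N := by
      rw [integral_sub (hGi N) (integrable_finsetSum _ hSi), integral_finsetSum _ hSi]
      congr 1
      refine Finset.sum_congr rfl fun j _ => ?_
      rw [integral_smul]
    rw [hint]
    calc ‖∫ y, (G N y - ∑ j ∈ J, a j • Y j N y) ∂μ N‖
        ≤ ∫ y, ‖G N y - ∑ j ∈ J, a j • Y j N y‖ ∂μ N := norm_integral_le_integral_norm _
      _ ≤ ∫ y, τ * W N y ∂μ N :=
          integral_mono_of_nonneg (ae_of_all _ fun y => norm_nonneg _) ((hWi N).const_mul τ)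
            (ae_of_all _ fun y => hGY N y)
      _ = τ * ∫ y, W N y ∂μ N := integral_const_mul _ _
      _ ≤ τ * M := mul_le_mul_of_nonneg_left (hWM N) hτ
      _ ≤ δ / 4 := hτM
  refine ⟨C₁ + C₂, add_pos hC₁ hC₂, fun N => ?_⟩
  have hsub : {x | δ < ‖G N x - ∫ y, G N y ∂μ N‖} ⊆
      B N ∪ {x | δ / 2 < ‖∑ j ∈ J, a j • (Y j N x - ∫ y, Y j N y ∂μ N)‖} := by
    intro x hx
    simp only [mem_setOf_eq, mem_union] at hx ⊢
    by_contra hcon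
    rw [not_or, not_lt] at hcon
    have h1 : ‖G N x - ∑ j ∈ J, a j • Y j N x‖ ≤ δ / 8 :=
      (hGY N x).trans ((mul_le_mul_of_nonneg_left (hWL N x hcon.1) hτ).trans hτL)
    have h2 : ∑ j ∈ J, a j • (Y j N x - ∫ y, Y j N y ∂μ N) =
        (∑ j ∈ J, a j • Y j N x) - ∑ j ∈ J, a j • ∫ y, Y j N y ∂μ N := by
      simp only [smul_sub, Finset.sum_sub_distrib]
    have h3 := hmean N
    have e : G N x - ∫ y, G N y ∂μ N = (G N x - ∑ j ∈ J, a j • Y j N x) +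
        ((∑ j ∈ J, a j • Y j N x) - ∑ j ∈ J, a j • ∫ y, Y j N y ∂μ N) -
        ((∫ y, G N y ∂μ N) - ∑ j ∈ J, a j • ∫ y, Y j N y ∂μ N) := by abel
    have h4 : ‖G N x - ∫ y, G N y ∂μ N‖ ≤ ‖G N x - ∑ j ∈ J, a j • Y j N x‖ +
        ‖(∑ j ∈ J, a j • Y j N x) - ∑ j ∈ J, a j • ∫ y, Y j N y ∂μ N‖ +
        ‖(∫ y, G N y ∂μ N) - ∑ j ∈ J, a j • ∫ y, Y j N y ∂μ N‖ := by
      rw [e]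
      exact (norm_sub_le _ _).trans (add_le_add (norm_add_le _ _) le_rfl)
    rw [← h2] at h4
    linarith [hcon.2]
  calc μ N {x | δ < ‖G N x - ∫ y, G N y ∂μ N‖}
      ≤ μ N (B N) + μ N {x | δ / 2 < ‖∑ j ∈ J, a j • (Y j N x - ∫ y, Y j N y ∂μ N)‖} :=
        (measure_mono hsub).trans (measure_union_le _ _)
    _ ≤ ENNReal.ofReal (C₁ * Real.exp (-(C₁⁻¹ * ((N : ℝ) + 1)))) +
          ENNReal.ofReal (C₂ * Real.exp (-(C₂⁻¹ * ((N : ℝ) + 1)))) := add_le_add (hBμ N) (h₂ N)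
    _ ≤ ENNReal.ofReal ((C₁ + C₂) * Real.exp (-((C₁ + C₂)⁻¹ * ((N : ℝ) + 1)))) :=
        UniformLGC.ofReal_Kexp_add_le hC₁ hC₂ (by positivity)

/-! ### Fourier tails -/

/-- **Uniform tails of a dominated function series.** If `|f_k(x)| ≤ b_k` with `∑ b_k < ∞` and
`∑_k f_k(x) = F(x)` for every `x`, then for every `ε > 0` some finite partial sum is uniformly
`ε`-close to `F`. [folklore] -/
theorem exists_finset_uniform_tail {ι X : Type*} (f : ι → X → ℝ) (b : ι → ℝ) (F : X → ℝ)
    (hb : Summable b) (hfb : ∀ k x, |f k x| ≤ b k) (hf : ∀ x, HasSum (fun k => f k x) (F x))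
    {ε : ℝ} (hε : 0 < ε) : ∃ S : Finset ι, ∀ x, |F x - ∑ k ∈ S, f k x| ≤ ε := by
  classical
  have hB : Tendsto (fun S : Finset ι => ∑ k ∈ S, b k) atTop (𝓝 (∑' k, b k)) := hb.hasSum
  have hev : ∀ᶠ S : Finset ι in atTop, (∑' k, b k) - ε < ∑ k ∈ S, b k :=
    hB.eventually (lt_mem_nhds (by linarith))
  obtain ⟨S, hS⟩ := hev.exists
  refine ⟨S, fun x => ?_⟩
  have hT : Tendsto (fun T : Finset ι => |∑ k ∈ T, f k x - ∑ k ∈ S, f k x|) atTop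
      (𝓝 |F x - ∑ k ∈ S, f k x|) :=
    (continuous_abs.tendsto _).comp ((hf x).sub_const _)
  refine le_of_tendsto hT ?_
  filter_upwards [eventually_ge_atTop S] with T hST
  rw [← Finset.sum_sdiff hST, add_sub_cancel_right]
  calc |∑ k ∈ T \ S, f k x| ≤ ∑ k ∈ T \ S, |f k x| := Finset.abs_sum_le_sum_abs _ _
    _ ≤ ∑ k ∈ T \ S, b k := Finset.sum_le_sum fun k _ => hfb k x
    _ = ∑ k ∈ T, b k - ∑ k ∈ S, b k := by rw [← Finset.sum_sdiff hST, add_sub_cancel_right]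
    _ ≤ (∑' k, b k) - ∑ k ∈ S, b k :=
        sub_le_sub_right (hb.sum_le_tsum T fun k _ => (abs_nonneg _).trans (hfb k x)) _
    _ ≤ ε := by linarith

/-- **Real Fourier expansion of a smooth real function on `𝕋ᵈ`**: with `ĝ` the Fourier
coefficients of `x ↦ (χ x : ℂ)`, `∑_k ‖ĝ k‖ < ∞` and
`χ x = ∑_k (Re ĝ_k · Re e_k(x) − Im ĝ_k · Im e_k(x))`. [folklore] -/
theorem hasSum_re_fourier_of_isSmooth {d : Type*} [Fintype d] [DecidableEq d]
    {χ : UnitAddTorus d → ℝ} (hχ : Torus.IsSmooth χ) :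
    Summable (fun k => ‖UnitAddTorus.mFourierCoeff (fun x => (χ x : ℂ)) k‖) ∧
    ∀ x, HasSum (fun k => (UnitAddTorus.mFourierCoeff (fun x => (χ x : ℂ)) k).re *
        (UnitAddTorus.mFourier k x).re -
      (UnitAddTorus.mFourierCoeff (fun x => (χ x : ℂ)) k).im * (UnitAddTorus.mFourier k x).im)
      (χ x) := by
  have hg : Torus.IsSmooth (fun x => (χ x : ℂ)) := hχ.comp_clm Complex.ofRealCLM
  have hc := hg.rapidDecay_mFourierCoeff
  refine ⟨hc.summable_norm, fun x => ?_⟩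
  have h1 := hc.hasSum_fourierSynth x
  rw [hg.fourierSynth_mFourierCoeff] at h1
  have h2 := Complex.hasSum_re h1
  simp only [Complex.ofReal_re, smul_eq_mul, Complex.mul_re] at h2
  convert h2 using 1
  funext k
  ring

/-- `|Re ĝ_k · Re e_k(x) − Im ĝ_k · Im e_k(x)| ≤ ‖ĝ_k‖`. [folklore] -/
theorem abs_re_fourier_term_le {d : Type*} [Fintype d] (c : ℂ) (k : d → ℤ) (x : UnitAddTorus d) :
    |c.re * (UnitAddTorus.mFourier k x).re - c.im * (UnitAddTorus.mFourier k x).im| ≤ ‖c‖ := by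
  have h : c.re * (UnitAddTorus.mFourier k x).re - c.im * (UnitAddTorus.mFourier k x).im =
      (c * UnitAddTorus.mFourier k x).re := by rw [Complex.mul_re]
  rw [h]
  calc _ ≤ ‖c * UnitAddTorus.mFourier k x‖ := Complex.abs_re_le_norm _
    _ = ‖c‖ := by rw [norm_mul, Torus.norm_mFourier_apply, mul_one]

/-! ### Linearity of the tested empirical fields in the test function -/

/-- The empirical density field is linear in the test function (finite linear combinations).
[folklore] -/
theorem empiricalDensityField_finset_sum_mul {N : ℕ} {ι : Type*} (z : Config N (Fin 3) T3)
    (J : Finset ι) (a : ι → ℝ) (ψ : ι → T3 → ℝ) :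
    empiricalDensityField z (fun x => ∑ j ∈ J, a j * ψ j x) =
      ∑ j ∈ J, a j • empiricalDensityField z (ψ j) := by
  simp only [empiricalDensityField_eq_sum, smul_eq_mul, Finset.mul_sum]
  rw [Finset.sum_comm]
  exact Finset.sum_congr rfl fun j _ => Finset.sum_congr rfl fun i _ => by ring

/-- The empirical momentum field is linear in the test function (finite linear combinations).
[folklore] -/
theorem empiricalMomentumField_finset_sum_mul {N : ℕ} {ι : Type*} (z : Config N (Fin 3) T3)
    (J : Finset ι) (a : ι → ℝ) (ψ : ι → T3 → ℝ) :
    empiricalMomentumField z (fun x => ∑ j ∈ J, a j * ψ j x) =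
      ∑ j ∈ J, a j • empiricalMomentumField z (ψ j) := by
  simp only [empiricalMomentumField_eq_sum, Finset.sum_smul, Finset.smul_sum, smul_smul]
  rw [Finset.sum_comm]
  exact Finset.sum_congr rfl fun j _ => Finset.sum_congr rfl fun i _ => by rw [mul_left_comm]

/-- The empirical energy field is linear in the test function (finite linear combinations).
[folklore] -/
theorem empiricalEnergyField_finset_sum_mul {N : ℕ} {ι : Type*} (z : Config N (Fin 3) T3)
    (J : Finset ι) (a : ι → ℝ) (ψ : ι → T3 → ℝ) :
    empiricalEnergyField z (fun x => ∑ j ∈ J, a j * ψ j x) =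
      ∑ j ∈ J, a j • empiricalEnergyField z (ψ j) := by
  simp only [empiricalEnergyField_eq_sum, smul_eq_mul, Finset.mul_sum, Finset.sum_mul]
  rw [Finset.sum_comm]
  exact Finset.sum_congr rfl fun j _ => Finset.sum_congr rfl fun i _ => by ring

/-- **Bounds of the tested fields**: for `|ψ| ≤ b`, `|ρ_ψ(z)| ≤ b`, `‖m_ψ(z)‖ ≤ b (1/2 + e_1(z))`,
`|e_ψ(z)| ≤ b e_1(z)` (`empiricalFields_sub_le` against the zero test function). [folklore] -/
theorem empiricalFields_le_of_abs_le {N : ℕ} (z : Config (N + 1) (Fin 3) T3) {ψ : T3 → ℝ} {b : ℝ}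
    (hb : ∀ x, |ψ x| ≤ b) :
    |empiricalDensityField z ψ| ≤ b ∧
    ‖empiricalMomentumField z ψ‖ ≤ b * (1 / 2 + empiricalEnergyField z (fun _ => 1)) ∧
    |empiricalEnergyField z ψ| ≤ b * empiricalEnergyField z (fun _ => 1) := by
  have h := empiricalFields_sub_le z (χ := ψ) (ψ := fun _ => 0) (δ' := b)
    (fun x => by rw [zero_sub, abs_neg]; exact hb x)
  have h0 : empiricalDensityField z (fun _ => (0 : ℝ)) = 0 := by simp [empiricalDensityField_eq_sum]
  have h1 : empiricalMomentumField z (fun _ => (0 : ℝ)) = 0 := by simp [empiricalMomentumField_eq_sum]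
  have h2 : empiricalEnergyField z (fun _ => (0 : ℝ)) = 0 := by simp [empiricalEnergyField_eq_sum]
  rw [h0, h1, h2, zero_sub, zero_sub, zero_sub, abs_neg, norm_neg, abs_neg] at h
  exact h

/-- **The kinetic energy per particle along the Lambertian flow is nonnegative and does not
increase**: `0 ≤ e_1(Λ_t(z, ξ)) ≤ e_1(z)` (`e_1 = (N+1)⁻¹ · configEnergy`,
`configEnergy_lambertFlow_le`). [folklore] -/
theorem kineticEnergy_lambertFlow_bounds {N : ℕ} (ε : ℝ) (ξs : ℕ → EuclideanSpace ℝ (Fin 3))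
    (z : Config (N + 1) (Fin 3) T3) (t : ℝ) :
    0 ≤ empiricalEnergyField (lambertFlow (Torus.geometry (Fin 3)) ε ξs z t) (fun _ => 1) ∧
    empiricalEnergyField (lambertFlow (Torus.geometry (Fin 3)) ε ξs z t) (fun _ => 1) ≤
      empiricalEnergyField z (fun _ => 1) := by
  rw [empiricalEnergyField_one_eq, empiricalEnergyField_one_eq]
  refine ⟨?_, mul_le_mul_of_nonneg_left (configEnergy_lambertFlow_le _ _ _) (by positivity)⟩
  rw [configEnergy]
  positivity

/-! ### The kinetic energy per particle is uniformly integrable under the local Gibbs laws -/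

/-- **Uniform first moment of the kinetic energy per particle under the local Gibbs laws**
(`σ ≤ 1/2`, continuous profiles): `e_1` is `P_N`-integrable with `∫ e_1 dP_N ≤ K'` for all `N`
and all flows (`exists_lintegral_sum_norm_sq_localGibbsLaw_le`). [folklore] -/
theorem exists_integral_empiricalEnergyField_one_le {a θ : T3 → ℝ} {u : T3 → V3}
    (ha : Continuous a) (hθ : Continuous θ) (hu : Continuous u) (ha0 : ∀ x, 0 < a x)
    (hθ0 : ∀ x, 0 < θ x) {σ : ℝ} (hσ2 : σ ≤ 1 / 2) :
    ∃ K' : ℝ, 0 ≤ K' ∧ ∀ (N : ℕ)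
      (Φ : HardSphereFlow (Torus.geometry (Fin 3)) (hsDiameter σ N) (N + 1)),
      Integrable (fun z => empiricalEnergyField z (fun _ => 1)) (localGibbsLaw σ a u θ N Φ) ∧
      ∫ z, empiricalEnergyField z (fun _ => 1) ∂localGibbsLaw σ a u θ N Φ ≤ K' := by
  obtain ⟨C, hC0, hC⟩ := exists_lintegral_sum_norm_sq_localGibbsLaw_le ha hθ hu ha0 hθ0 hσ2
  refine ⟨C / 2, by positivity, fun N Φ => ?_⟩
  set P := localGibbsLaw σ a u θ N Φ with hP
  set f : Config (N + 1) (Fin 3) T3 → ℝ := fun z => ∑ i, ‖(z i).2‖ ^ 2 with hf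
  have hfm : Measurable f :=
    Finset.measurable_sum _ fun i _ => ((measurable_pi_apply i).snd.norm).pow_const 2
  have hf0 : ∀ z, 0 ≤ f z := fun z => Finset.sum_nonneg fun i _ => by positivity
  have hfi : Integrable f P := by
    refine ⟨hfm.aestronglyMeasurable, ?_⟩
    rw [hasFiniteIntegral_iff_ofReal (ae_of_all _ hf0)]
    exact (hC N Φ).trans_lt ENNReal.ofReal_lt_top
  have hfint : ∫ z, f z ∂P ≤ C * ((N : ℝ) + 1) := by
    have h := hC N Φ
    rw [← ofReal_integral_eq_lintegral_ofReal hfi (ae_of_all _ hf0)] at h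
    exact (ENNReal.ofReal_le_ofReal_iff (by positivity)).1 h
  have hN : (0 : ℝ) < ((N + 1 : ℕ) : ℝ) := by positivity
  have he : (fun z : Config (N + 1) (Fin 3) T3 => empiricalEnergyField z (fun _ => 1)) =
      fun z => ((((N + 1 : ℕ) : ℝ))⁻¹ * 2⁻¹) * f z := by
    funext z
    rw [empiricalEnergyField_one_eq, configEnergy, mul_assoc]
  rw [he]
  refine ⟨hfi.const_mul _, ?_⟩
  rw [integral_const_mul]
  have hN' : ((N + 1 : ℕ) : ℝ) = (N : ℝ) + 1 := by push_cast; ring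
  calc (((N + 1 : ℕ) : ℝ))⁻¹ * 2⁻¹ * ∫ z, f z ∂P
      ≤ (((N + 1 : ℕ) : ℝ))⁻¹ * 2⁻¹ * (C * ((N : ℝ) + 1)) :=
        mul_le_mul_of_nonneg_left hfint (by positivity)
    _ = C / 2 := by rw [hN']; field_simp

/-- **Integrability of the tested fields of the Lambertian flow under `P_N ⊗ γ^ℕ`** for
continuous `ψ` and `0 ≤ σ < 1/2`, given integrability of `e_1` under `P_N`: all three statistics
are measurable and dominated by `sup|ψ| · (1 + e_1(p.1))`. [folklore] -/
theorem integrable_fields_lambertFlow {a θ : T3 → ℝ} {u : T3 → V3} {σ : ℝ} (hσ : 0 ≤ σ)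
    (hσ' : σ < 2⁻¹) (N : ℕ) (Φ : HardSphereFlow (Torus.geometry (Fin 3)) (hsDiameter σ N) (N + 1))
    (hPN : IsProbabilityMeasure (localGibbsLaw σ a u θ N Φ))
    (hint : Integrable (fun z => empiricalEnergyField z (fun _ => 1)) (localGibbsLaw σ a u θ N Φ))
    (t : ℝ) {ψ : T3 → ℝ} (hψ : Continuous ψ) :
    Integrable (fun p : Config (N + 1) (Fin 3) T3 × (ℕ → EuclideanSpace ℝ (Fin 3)) =>
        empiricalDensityField (lambertFlow (Torus.geometry (Fin 3)) (hsDiameter σ N) p.2 p.1 t) ψ)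
      ((localGibbsLaw σ a u θ N Φ).prod (lambertNoise (Fin 3))) ∧
    Integrable (fun p : Config (N + 1) (Fin 3) T3 × (ℕ → EuclideanSpace ℝ (Fin 3)) =>
        empiricalMomentumField (lambertFlow (Torus.geometry (Fin 3)) (hsDiameter σ N) p.2 p.1 t) ψ)
      ((localGibbsLaw σ a u θ N Φ).prod (lambertNoise (Fin 3))) ∧
    Integrable (fun p : Config (N + 1) (Fin 3) T3 × (ℕ → EuclideanSpace ℝ (Fin 3)) =>
        empiricalEnergyField (lambertFlow (Torus.geometry (Fin 3)) (hsDiameter σ N) p.2 p.1 t) ψ)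
      ((localGibbsLaw σ a u θ N Φ).prod (lambertNoise (Fin 3))) := by
  haveI := hPN
  obtain ⟨b, hb0, hb⟩ := exists_abs_le_of_continuous_T3 hψ
  have hΛ := measurable_lambertFlow_hsDiameter hσ hσ' N t
  have hW : Integrable (fun p : Config (N + 1) (Fin 3) T3 × (ℕ → EuclideanSpace ℝ (Fin 3)) =>
      b * (1 + empiricalEnergyField p.1 (fun _ => 1)))
      ((localGibbsLaw σ a u θ N Φ).prod (lambertNoise (Fin 3))) :=
    (((integrable_const (1 : ℝ)).add hint).comp_fst (lambertNoise (Fin 3))).const_mul b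
  have key : ∀ p : Config (N + 1) (Fin 3) T3 × (ℕ → EuclideanSpace ℝ (Fin 3)),
      |empiricalDensityField (lambertFlow (Torus.geometry (Fin 3)) (hsDiameter σ N) p.2 p.1 t) ψ| ≤
        b * (1 + empiricalEnergyField p.1 (fun _ => 1)) ∧
      ‖empiricalMomentumField (lambertFlow (Torus.geometry (Fin 3)) (hsDiameter σ N) p.2 p.1 t) ψ‖ ≤
        b * (1 + empiricalEnergyField p.1 (fun _ => 1)) ∧
      |empiricalEnergyField (lambertFlow (Torus.geometry (Fin 3)) (hsDiameter σ N) p.2 p.1 t) ψ| ≤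
        b * (1 + empiricalEnergyField p.1 (fun _ => 1)) := by
    intro p
    obtain ⟨h1, h2, h3⟩ :=
      empiricalFields_le_of_abs_le (lambertFlow (Torus.geometry (Fin 3)) (hsDiameter σ N) p.2 p.1 t) hb
    obtain ⟨he0, he⟩ := kineticEnergy_lambertFlow_bounds (hsDiameter σ N) p.2 p.1 t
    refine ⟨h1.trans ?_, h2.trans ?_, h3.trans ?_⟩
    · exact le_mul_of_one_le_right hb0 (by linarith)
    · exact mul_le_mul_of_nonneg_left (by linarith) hb0
    · exact mul_le_mul_of_nonneg_left (by linarith) hb0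
  refine ⟨?_, ?_, ?_⟩
  · refine hW.mono' (((measurable_empiricalDensityField hψ).comp hΛ).aestronglyMeasurable)
      (ae_of_all _ fun p => ?_)
    rw [Real.norm_eq_abs]
    exact (key p).1
  · refine hW.mono' (((measurable_empiricalMomentumField hψ).comp hΛ).aestronglyMeasurable)
      (ae_of_all _ fun p => (key p).2.1)
  · refine hW.mono' (((measurable_empiricalEnergyField hψ).comp hΛ).aestronglyMeasurable)
      (ae_of_all _ fun p => ?_)
    rw [Real.norm_eq_abs]
    exact (key p).2.2

end Summit.AtomisticToContinuum.HydrodynamicLimit.Theorems.LinearConcentrationOfFourierModes
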